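import Literature.Barriers.CriticalPhenomena.WeaklySAWFieldDoubling
import Literature.MathematicalPhysics.QuantumLattice.GrassmannIntegralBerezinProofs
import HarnessLib

/-!
# BBS 2015, §4.1, eqs. (4.22)–(4.23): the Gaussian super-expectation in the fluctuation fields,
# `E_C θ : 𝒩 → 𝒩`, and `E_C θ f = μ_C * f` for `0`-forms

Sequel to `WeaklySAWFieldDoubling.lean` (`𝒩^× = SForm2 Λ`, `θ : 𝒩 → 𝒩^×`). Bauerschmidt–Brydges–Slade,
CMP 337 (2015), arXiv:1403.7422, §4.1: "we understand the map `E_C ∘ θ : 𝒩 → 𝒩` as the integration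
with respect to the fluctuation fields `ξ` and `η`, with the fields `φ` and `ψ` left fixed. This is like
a conditional expectation. For example, if `F = f(φ)` is of degree `0`, then
`E_Cθ F = μ_C * f = E_C(f(φ+ξ) | φ)` ((4.22))."

* `etaSet` (the `η̄, η` generators), **`fluctExpectation A : SForm2 Λ → SForm Λ`** — `E_C` in the
  fluctuation fields, `C = A⁻¹`: insert `e^{-S_A(ξ,η)}` (`embedEta (superGauss A)`), integrate the
  `η`-generators (`berezinOn` of the tree), read off the coefficient of each monomial of the
  `ψ`-block (`fluctCoeff`), and integrate it in `ξ` with the normalisation `ε π^{-|Λ|}` of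
  `superIntegral` (the boson field `φ` being a parameter);
* **`convTheta A F = E_C θ F`** ((4.23): `Z_N = E_Cθ Z₀` is `convTheta A Z₀`);
* `gaussConvolution A f φ = (det A/π^{|Λ|}) ∫ f(φ+ξ) e^{-ξAξ̄} dξ` (the Gaussian convolution `μ_C * f`:
  `gaussConvolution_eq_div` records that this is `∫f(φ+ξ)e^{-ξAξ̄}dξ / ∫e^{-ξAξ̄}dξ` when `A` has
  positive Hermitian part, `Z_C = π^{|Λ|}/det A`), and the theorem **`convTheta_ofFun`** = eq. (4.22):
  `E_C θ f = μ_C * f` for every `0`-form `f` and every matrix `A`; `convTheta_one`: `E_C θ 1 = 1`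
  (`A` with positive Hermitian part).

Everything is proved; no named facts.
-/

noncomputable section

open MeasureTheory Complex ComplexConjugate
open Literature.MathematicalPhysics.QuantumLattice
open Literature.MathematicalPhysics.QuantumLattice.GrassmannAlgebra (berezin gen coeffMap grassmannBasis berezinOn)
open scoped BigOperators

namespace Literature.Barriers.CriticalPhenomena

namespace CTWSAW

section Fluctuation

variable {Λ : Type*} [LinearOrder Λ] [Fintype Λ]

/-- The set of the `η̄, η` generators of `𝒩^×`. [folklore] -/
def etaSet (Λ : Type*) [LinearOrder Λ] [Fintype Λ] : Finset (DGen Λ) :=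
  Finset.univ.map (blockEta Λ).toEmbedding

/-- The `ξ`-integrated coefficient of the `ψ`-monomial `θ_s` of a form of `𝒩^×`, as a function of the
external field `φ` (normalisation `ε π^{-|Λ|}` as in `superIntegral`). [folklore] -/
def fluctCoeffOf (K : SForm2 Λ) (s : Finset (Λ ⊕ₗ Λ)) : FieldFun Λ :=
  fun φ => orientSign Λ * ((Real.pi : ℂ)⁻¹) ^ Fintype.card Λ *
    ∫ ξ : Λ → ℂ, (grassmannBasis (FieldFun2 Λ) (DGen Λ)).repr K (s.map (blockPsi Λ).toEmbedding) (φ, ξ)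

/-- **The Gaussian super-expectation in the fluctuation fields `(ξ, η)`**, `K ↦ E_C K`, `C = A⁻¹`, a map
`𝒩^× → 𝒩` ("the integration with respect to the fluctuation fields `ξ` and `η`, with the fields `φ` and `ψ`
left fixed"): `∫dη̄dη` of `e^{-S_A(ξ,η)}K`, then `ε π^{-|Λ|}∫dξ` of the coefficient of each `ψ`-monomial.
[cite: BauerschmidtBrydgesSlade2015LogCorr, §4.1 (the map E_C ∘ θ : 𝒩 → 𝒩 as integration over ξ and η)] -/
def fluctExpectation (A : Matrix Λ Λ ℂ) (K : SForm2 Λ) : SForm Λ :=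
  ∑ s : Finset (Λ ⊕ₗ Λ), fluctCoeffOf (berezinOn (FieldFun2 Λ) (etaSet Λ) (embedEta (superGauss A) * K)) s •
    grassmannBasis (FieldFun Λ) (Λ ⊕ₗ Λ) s

/-- **`E_C θ F`** — the Gaussian convolution of a form (`C = A⁻¹`); in particular `Z_N = E_C θ Z₀` ((4.23)).
[cite: BauerschmidtBrydgesSlade2015LogCorr, §4.1, eqs. (4.22)–(4.23)] -/
def convTheta (A : Matrix Λ Λ ℂ) (F : SForm Λ) : SForm Λ := fluctExpectation A (thetaForm F)

/-- **The Gaussian convolution `μ_C * f`**, `C = A⁻¹`: `(μ_C * f)(φ) = (det A/π^{|Λ|}) ∫ f(φ+ξ) e^{-ξAξ̄} dξ`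
(the normalised complex Gaussian measure `dμ_C = Z_C⁻¹e^{-ξAξ̄}dξ̄dξ`, `Z_C = π^{|Λ|}/det A`).
[cite: BauerschmidtBrydgesSlade2015LogCorr, §3.4, eq. (3.14) (dμ_C) and §4.1, eq. (4.22) (μ_C * f)] -/
def gaussConvolution (A : Matrix Λ Λ ℂ) (f : FieldFun Λ) : FieldFun Λ :=
  fun φ => A.det / (Real.pi : ℂ) ^ Fintype.card Λ * ∫ ξ : Λ → ℂ, f (φ + ξ) * Boson.gaussWeight A ξ

/-- For `A` with positive Hermitian part, `μ_C * f` is the normalised Gaussian average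
`∫f(φ+ξ)e^{-ξAξ̄}dξ / ∫e^{-ξAξ̄}dξ` (`Z_C = π^{|Λ|}/det A`, [BIS09, Lemma 2.1]). [cite: BrydgesImbrieSlade2009, Lemma 2.1] -/
theorem gaussConvolution_eq_div {A : Matrix Λ Λ ℂ} {c : ℝ} (hc : 0 < c)
    (hA : ∀ φ, c * ∑ x, ‖φ x‖ ^ 2 ≤ (Boson.quadForm A φ).re) (f : FieldFun Λ) (φ : Λ → ℂ) :
    gaussConvolution A f φ = (∫ ξ : Λ → ℂ, f (φ + ξ) * Boson.gaussWeight A ξ) / Boson.partitionFn A := by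
  have hpi : (Real.pi : ℂ) ^ Fintype.card Λ ≠ 0 := pow_ne_zero _ (by exact_mod_cast Real.pi_ne_zero)
  have hZ : Boson.partitionFn A ≠ 0 := by
    intro h0
    have h := det_mul_partitionFn_eq hc hA
    rw [h0, mul_zero] at h
    exact hpi h.symm
  rw [gaussConvolution, partitionFn_eq hc hA]
  field_simp

/-! #### The computation of `E_C θ f` -/

/-- `e^{-S_A(ξ,η)}` in `𝒩^×`: `e^{-ξAξ̄} · (the η-block Gaussian)`. [folklore] -/
theorem embedEta_superGauss (A : Matrix Λ Λ ℂ) :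
    embedEta (superGauss A) = ofFun2 (fun p => Boson.gaussWeight A p.2) *
      mapEta (coeffMap fluctCoeff (grassmannExp (-fermionAction A))) := by
  rw [superGauss, map_mul, embedEta_ofFun, embedEta_apply]

/-- The `η`-integral of the `η`-block Gaussian is the constant `ε det A`. [folklore] -/
theorem berezinOn_etaSet_mapEta_grassmannExp (A : Matrix Λ Λ ℂ) :
    berezinOn (FieldFun2 Λ) (etaSet Λ) (mapEta (coeffMap fluctCoeff (grassmannExp (-fermionAction A)))) =
      ofFun2 (fun _ => orientSign Λ * A.det) := by
  rw [etaSet, mapEta, GrassmannAlgebra.berezinOn_map_map_extendByZero,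
    GrassmannAlgebra.berezinOn_univ_holds (FieldFun2 Λ) _, AlgHom.commutes, GrassmannAlgebra.berezin_coeffMap,
    berezin_grassmannExp_neg_fermionAction]
  rfl

/-- `0`-forms pass through the partial Berezin integral. [folklore] -/
theorem berezinOn_ofFun2_mul (s : Finset (DGen Λ)) (h : FieldFun2 Λ) (K : SForm2 Λ) :
    berezinOn (FieldFun2 Λ) s (ofFun2 h * K) = ofFun2 h * berezinOn (FieldFun2 Λ) s K := by
  rw [ofFun2, ← Algebra.smul_def, map_smul, Algebra.smul_def]

/-- The `η`-integral of `e^{-S_A(ξ,η)} g(φ,ξ)`: the `0`-form `ε det A · e^{-ξAξ̄} g`. [folklore] -/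
theorem berezinOn_etaSet_superGauss_mul_ofFun2 (A : Matrix Λ Λ ℂ) (g : FieldFun2 Λ) :
    berezinOn (FieldFun2 Λ) (etaSet Λ) (embedEta (superGauss A) * ofFun2 g) =
      ofFun2 (fun p => Boson.gaussWeight A p.2 * g p * (orientSign Λ * A.det)) := by
  rw [embedEta_superGauss, mul_assoc, show mapEta (coeffMap fluctCoeff (grassmannExp (-fermionAction A))) * ofFun2 g =
      ofFun2 g * mapEta (coeffMap fluctCoeff (grassmannExp (-fermionAction A))) from (Algebra.commutes g _).symm,
    ← mul_assoc, ofFun2, ofFun2, ← map_mul, ← ofFun2, berezinOn_ofFun2_mul, berezinOn_etaSet_mapEta_grassmannExp,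
    ofFun2, ofFun2, ← map_mul]
  rfl

/-- Coordinates of a `0`-form: only the empty monomial. [folklore] -/
theorem repr_ofFun2 (h : FieldFun2 Λ) (t : Finset (DGen Λ)) :
    (grassmannBasis (FieldFun2 Λ) (DGen Λ)).repr (ofFun2 h) t = if t = ∅ then h else 0 := by
  classical
  rw [ofFun2, Algebra.algebraMap_eq_smul_one, map_smul, Finsupp.smul_apply, smul_eq_mul,
    ← GrassmannAlgebra.grassmannBasis_empty, Module.Basis.repr_self, Finsupp.single_apply]
  by_cases ht : t = ∅
  · subst ht; simp
  · rw [if_neg (Ne.symm ht), if_neg ht, mul_zero]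

/-- **BBS 2015, eq. (4.22): `E_C θ f = μ_C * f`** for a `0`-form `f` (`C = A⁻¹`; every matrix `A`; for the
interpretation as the Gaussian conditional expectation `E_C(f(φ+ξ) | φ)` see `gaussConvolution_eq_div`).
[cite: BauerschmidtBrydgesSlade2015LogCorr, §4.1, eq. (4.22)] -/
theorem convTheta_ofFun (A : Matrix Λ Λ ℂ) (f : FieldFun Λ) :
    convTheta A (ofFun f) = ofFun (gaussConvolution A f) := by
  classical
  have hε : orientSign Λ * orientSign Λ = 1 := orientSign_mul_self Λ
  rw [convTheta, thetaForm_ofFun, fluctExpectation, berezinOn_etaSet_superGauss_mul_ofFun2]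
  -- only the empty monomial survives
  rw [Finset.sum_eq_single (∅ : Finset (Λ ⊕ₗ Λ))]
  · rw [GrassmannAlgebra.grassmannBasis_empty, ofFun, Algebra.algebraMap_eq_smul_one]
    congr 1
    funext φ
    simp only [fluctCoeffOf, Finset.map_empty, repr_ofFun2, if_true, gaussConvolution]
    rw [← integral_const_mul, ← integral_const_mul]
    refine integral_congr_ae (Filter.Eventually.of_forall fun ξ => ?_)
    simp only
    linear_combination (((Real.pi : ℂ)⁻¹) ^ Fintype.card Λ * Boson.gaussWeight A ξ * f (φ + ξ) * A.det) * hε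
  · intro s _ hs
    have hne : s.map (blockPsi Λ).toEmbedding ≠ ∅ := fun h => hs (Finset.map_eq_empty.1 h)
    have h0 : fluctCoeffOf (ofFun2 fun p : (Λ → ℂ) × (Λ → ℂ) => Boson.gaussWeight A p.2 * f (p.1 + p.2) *
        (orientSign Λ * A.det)) s = 0 := by
      funext φ
      simp only [fluctCoeffOf, repr_ofFun2, if_neg hne, Pi.zero_apply, integral_zero, mul_zero]
    rw [h0, zero_smul]
  · intro h; exact absurd (Finset.mem_univ _) h

/-- **`E_C θ 1 = 1`** for `A` with positive Hermitian part (`∫dμ_C = 1`). [cite: BauerschmidtBrydgesSlade2015LogCorr, §4.1 ("the partition function E_C Z₀ is equal to 1"; case Z₀ = 1)] -/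
theorem convTheta_one {A : Matrix Λ Λ ℂ} {c : ℝ} (hc : 0 < c)
    (hA : ∀ φ, c * ∑ x, ‖φ x‖ ^ 2 ≤ (Boson.quadForm A φ).re) :
    convTheta A (1 : SForm Λ) = 1 := by
  have h1 : (1 : SForm Λ) = ofFun 1 := (map_one _).symm
  rw [h1, convTheta_ofFun]
  congr 1
  funext φ
  have hpi : (Real.pi : ℂ) ^ Fintype.card Λ ≠ 0 := pow_ne_zero _ (by exact_mod_cast Real.pi_ne_zero)
  have hZ := det_mul_partitionFn_eq hc hA
  simp only [gaussConvolution, Pi.one_apply, one_mul]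
  rw [show (∫ ξ : Λ → ℂ, Boson.gaussWeight A ξ) = Boson.partitionFn A from rfl, div_mul_eq_mul_div, hZ, div_self hpi]

end Fluctuation

end CTWSAW

end Literature.Barriers.CriticalPhenomena
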